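import Literature.RepresentationTheory.MoeglinVignerasWaldspurger1987.RankOneThetaLiftLinesDisjoint
import Literature.RepresentationTheory.MoeglinVignerasWaldspurger1987.RankOneThetaLinesDoubledFunctional
import Literature.RepresentationTheory.HeisenbergGroup.QuadricVanishingOfRootFamilies
import Literature.RepresentationTheory.HeisenbergGroup.MetaplecticBoxBridge
import Literature.NumberTheory.GelbartRogawski1991.LocalUnitaryDiagonalDoubling
import Literature.RepresentationTheory.MoeglinVignerasWaldspurger1987.RankOneThetaLinesDoubledRootForm
import Literature.RepresentationTheory.HeisenbergGroup.PolarisationMoverTwoRootFamilies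
import HarnessLib

/-!
# [Liu2021, Lem. D.1 (3)] at `n = 3`, the `ε`-clause: rank-one theta lifts to `U(3)` from the two skew-hermitian LINES of
# different classes are DISJOINT — PROOF of the named fact `rankOne_theta_lines_disjoint` (row IV-4(c1))

Topic `RepresentationTheory/MoeglinVignerasWaldspurger1987`; one theorem, proof lane (no definition, no named fact).

`rankOne_theta_lines_disjoint_holds : rankOne_theta_lines_disjoint` (fact text `RankOneThetaLiftLinesDisjoint.lean`, p595679;
consumers: `a4-liuD3` binder hD3 via `SameClassChiOfIsoNonsplit` / `MuOfIsoNonsplit`, and `RankOneThetaLiftSeparation.lean` §3).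
The printed statements it recovers at `n = 3`: [Liu2021, App. D Lem. D.1 (3)] («if `n ≥ 3`, then `ω(μ', ε', χ')` is
isomorphic to `ω(μ, ε, χ)` if and only if `(μ', ε', χ') = (μ, ε, χ)`», proof l. 5255 «known when `n = 3` by [GR90,
Proposition 5.1.4]»), [HarrisKudlaSweet1996, Cor. 4.4] (theta dichotomy) and [SunZhu2015, Thm. 1.10] (conservation); it is
PROVED HERE by the anisotropic-doubling / root-subgroup support argument of the cell `hodgecm-mathlib` (plan of record
«compact (anisotropic) doubling», support form, B-plan1 KEY ec1053cf4b0ba556) — GR90 Prop. 5.1.4 is NOT used: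

* P1 (A-p15, `RankOneThetaLinesDoubledFunctional`): an isomorphism `Θ_{s₁}(χ₁) ≅ Θ_{s₂}(χ₂) ≠ 0` yields a non-zero linear
  functional `Λ` on the doubled Schrödinger model `𝒮(F_v^{3+3})` which is an eigenvector of every operator of the diagonal
  doubling `𝔻(u) = j̃(s₁ u, conj s₂ u)` (B-p05, `LocalUnitaryDiagonalDoubling`; bridge B-p01/B-p05);
* P2 (B-p10, `UnitaryGroupIsotropicRootSymplectic` / `UnitaryGroupHyperbolicSwap` / `UnitaryGroupIsotropicRootDuality`):
  `V = (E_v³, J)` is isotropic (`N = 3`, `u(F_v) = 4`); the root subgroup `n_b` of an isotropic `r` with partner `r'`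
  acts through `ι_δ` as `1 + b 𝔫` with `𝔫² = 0`, `⟨x, 𝔫 x⟩ = Nm h(r, x)`, images in duality;
* P3 (A-p15 p600366 + B-p17, `RankOneThetaLinesDoubledRootForm`): on the doubled space the two embeddings give the
  block nilpotent `𝔫_{δ₁} ⊕ a⁻¹ 𝔫_{δ₂}` (`δ₂ = a δ₁`), whose norm form `Nm λ₁ − a⁻¹ Nm λ₂` is ANISOTROPIC modulo its
  kernel exactly because the two lines are in different classes (`a ∉ Nm E_vˣ`);
* P4 (A-p05 / B-p01, `PolarisationMoverTwoRootFamilies`): one `g₀ ∈ Sp₁₂(F_v)` moves the two root families to a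
  Siegel-lower unipotent and to the partial-Weyl conjugate of one, with second-degree data supported and anisotropic on a
  quaternary block;
* P5 (B-p05 / B-p04 / B-p01, `MetaplecticImplementerConjugation`, `SchrodingerPartialFourierWeyl`), P6 (B-p01,
  `SchwartzBruhatQuadricSupport` …) and the ENGINE `QuadricVanishingOfRootFamilies.false_of_quasiInvariant_rootFamilies`
  (A-p15): a functional quasi-invariant under `ψ(b Q)` for an anisotropic quaternary `Q` and under its partial-Fourier
  conjugate is `0` (compact quadric shells + p-adic uncertainty) — contradiction.

Assembly skeleton by A-p15 (`A-provers/A-p15/hP34-interface.lean`, owner of row IV-4(c1)); the `hP34` input filled with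
B-p17's `exists_doubledRootNilpotents` and B-p01's `exists_mover_two_rootFamilies`; crew A-p15 · A-p05 · B-p01 · B-p04 ·
B-p05 · B-p10 · B-p11 · B-p17.  HC_CM is proved only modulo the remaining printed citations until rung 0 of the ladder closes.

## References
* [Liu2021] Y. Liu, Camb. J. Math. 9 (2021) = arXiv:2102.11518 — App. D Lem. D.1 (3) (l. 5233), proof l. 5255.
* [HarrisKudlaSweet1996] M. Harris, S. Kudla, W. J. Sweet, J. AMS 9 (1996) — Cor. 4.4 p. 962.
* [SunZhu2015] B. Sun, C.-B. Zhu, J. AMS 28 (2015) — Thm. 1.10.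
* [MoeglinVignerasWaldspurger1987] C. Mœglin, M.-F. Vignéras, J.-L. Waldspurger, LNM 1291 (1987), Chap. 3 §IV.
-/

set_option autoImplicit false

noncomputable section

open NumberField IsDedekindDomain MeasureTheory Matrix
open Literature.RepresentationTheory Literature.RepresentationTheory.HeisenbergGroup
open Literature.NumberTheory.GelbartRogawski1991.UnitaryDualPair.LocalSplitting
open Literature.NumberTheory.Automorphic Literature.NumberTheory.Automorphic.UnitaryGroup
open Literature.NumberTheory.Automorphic.Liu2021

namespace Literature.RepresentationTheory.MoeglinVignerasWaldspurger1987

set_option maxHeartbeats 1000000 in -- the 17-binder `hP34` statement + the engine application (`400000` is not enough)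
/-- **[Liu2021, App. D Lem. D.1 (3)], `ε`-clause, at `n = 3` and a non-split place — PROVED**: a non-zero rank-one theta lift
to `U(J)(F_v)` (`J = T ⊗ 1` hermitian of rank `3`) from the line `W_{ε₁}` is never isomorphic to a rank-one theta lift from the
line `W_{ε₂}` of the other class of `E_v^{−×}/Nm E_vˣ`, for arbitrary splittings `s₁, s₂` over `ι_{δ₁}, ι_{δ₂}` and unitary
continuous `χ₁, χ₂` — the named fact `rankOne_theta_lines_disjoint` verbatim.  Proof: anisotropic doubling + root-subgroup
support argument (module docstring; pieces P1–P7 of the cell's line `b4-rank-one-theta-lines-disjoint`); the printed route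
[GelbartRogawski1990, Prop. 5.1.4] is not used. [cite: Liu2021, App. D Lemma D.1 (3) (l. 5233), proof l. 5255]
[cite: HarrisKudlaSweet1996, Cor. 4.4 p. 962] [cite: MoeglinVignerasWaldspurger1987, Chap. 3 IV.4] -/
theorem rankOne_theta_lines_disjoint_holds : rankOne_theta_lines_disjoint := by
  intro F _ _ E _ _ _ _ c δ₁ hcδ₁ hδ₁ d₁ hd₁ δ₂ hcδ₂ hδ₂ d₂ hd₂ T hT hTd J hJ v hE hcls s₁ s₂ hs₁ hs₂ hsm₁ hsm₂ J₁ hJ₁ χ₁ χ₂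
    hχ₁u hχ₁c hχ₂u hχ₂c hnt hiso
  classical
  -- P1: the doubled functional on `𝒮(F_v^{3+3})` along B-p05's `e₂ 3`
  obtain ⟨Λ, hΛ0, hΛ⟩ := exists_doubledFunctional_of_areIsomorphicRep F E c hcδ₁ hδ₁ 3 T hTd J v hE s₁ s₂ hsm₂ J₁ hJ₁ χ₁
    χ₂ hχ₂c hnt hiso (e₂ 3)
  -- P1 ↔ 𝔻: `Λ` is an eigenvector of every `op(𝔻 u)`
  have hΛ𝔻 : ∀ u : localPi E c 3 J v, ∃ r : ℂ, ∀ f,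
      Λ (MpPsi.toOp _ (diagonalDoubling F E c v 3 s₁ s₂ u) f) = r • Λ f := by
    intro u
    obtain ⟨r, -, h⟩ := hΛ u
    refine ⟨r, fun f => ?_⟩
    have key : ((MpPsi.toOp _ (diagonalDoubling F E c v 3 s₁ s₂ u) :
        SchwartzBruhat (Fin (3 + 3) → v.adicCompletion F) ≃ₗ[ℂ] SchwartzBruhat (Fin (3 + 3) → v.adicCompletion F)) :
        SchwartzBruhat (Fin (3 + 3) → v.adicCompletion F) →ₗ[ℂ] SchwartzBruhat (Fin (3 + 3) → v.adicCompletion F)) =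
        sumEndSB (v.adicCompletion F) (e₂ 3)
          ((((MpPsi.toRep (localSchrodinger F 3 T v)).comp s₁) u : SchwartzBruhat (Fin 3 → v.adicCompletion F) →ₗ[ℂ]
            SchwartzBruhat (Fin 3 → v.adicCompletion F)))
          (conjOp (MpPsi.toOp (localSchrodinger F 3 T v) (s₂ u))).toLinearMap := by
      rw [toOp_diagonalDoubling, boxEquivSB_toLinearMap, MonoidHom.comp_apply, MpPsi.toRep_eq_toOp]
    have h' := LinearMap.congr_fun h f
    rw [← key, LinearMap.comp_apply, LinearMap.smul_apply, LinearEquiv.coe_coe] at h'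
    exact h'
  -- the P6 coordinate splitting of the doubled index: `ι₁ = Fin 4` (quaternary block), `ι₂ = Fin 2`
  obtain ⟨e', -⟩ : ∃ _e : Fin 4 ⊕ Fin 2 ≃ Fin (3 + 3), True := ⟨finSumFinEquiv.trans (finCongr rfl), trivial⟩
  -- P3-CONCRETE (B-p17) + P4-FINAL (A-p05): the two root families, their doubled nilpotents, the mover and the forms
  have hP34 : ∃ (nr nr' : v.adicCompletion F → localPi E c 3 J v)
      (𝔫 𝔫' : ((Fin (3 + 3) → v.adicCompletion F) × (Fin (3 + 3) → v.adicCompletion F)) →ₗ[v.adicCompletion F]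
        ((Fin (3 + 3) → v.adicCompletion F) × (Fin (3 + 3) → v.adicCompletion F))),
      (∀ t w, ((MpPsi.proj _ (diagonalDoubling F E c v 3 s₁ s₂ (nr t)) : LocalSp F (3 + 3) (gramD F 3 T) v) :
        _ ≃ₗ[v.adicCompletion F] _) w = w + t • 𝔫 w) ∧
      (∀ t w, ((MpPsi.proj _ (diagonalDoubling F E c v 3 s₁ s₂ (nr' t)) : LocalSp F (3 + 3) (gramD F 3 T) v) :
        _ ≃ₗ[v.adicCompletion F] _) w = w + t • 𝔫' w) ∧
      ∃ (g₀ : LocalSp F (3 + 3) (gramD F 3 T) v)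
        (c₀ c₀' : (Fin (3 + 3) → v.adicCompletion F) →ₗ[v.adicCompletion F] (Fin (3 + 3) → v.adicCompletion F))
        (hc₀ : ∀ x x', localPairing F (3 + 3) (gramD F 3 T) v x (c₀ x') = localPairing F (3 + 3) (gramD F 3 T) v x' (c₀ x))
        (hc₀' : ∀ x x', localPairing F (3 + 3) (gramD F 3 T) v x (c₀' x') =
          localPairing F (3 + 3) (gramD F 3 T) v x' (c₀' x)),
        (∀ x, localPairing F (3 + 3) (gramD F 3 T) v x (c₀ x) =
          localPairing F (3 + 3) (gramD F 3 T) v (glue e' (resL e' x) 0)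
            (c₀ (glue e' (resL e' x) 0))) ∧
        (∀ x, localPairing F (3 + 3) (gramD F 3 T) v x (c₀' x) =
          localPairing F (3 + 3) (gramD F 3 T) v (glue e' (resL e' x) 0)
            (c₀' (glue e' (resL e' x) 0))) ∧
        (∀ ξ : Fin 4 → v.adicCompletion F,
          localPairing F (3 + 3) (gramD F 3 T) v (glue e' ξ 0) (c₀ (glue e' ξ 0)) = 0 → ξ = 0) ∧
        (∀ ξ : Fin 4 → v.adicCompletion F,
          localPairing F (3 + 3) (gramD F 3 T) v (glue e' ξ 0) (c₀' (glue e' ξ 0)) = 0 → ξ = 0) ∧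
        (∀ (t : v.adicCompletion F) (u : LocalSp F (3 + 3) (gramD F 3 T) v),
          (∀ w, (u : _ ≃ₗ[v.adicCompletion F] _) w = w + t • 𝔫 w) →
            g₀ * u * g₀⁻¹ = unipotentSp (localPairing F (3 + 3) (gramD F 3 T) v) (t • c₀)
              (symm_smul_of_symm (localPairing F (3 + 3) (gramD F 3 T) v) c₀ hc₀ t)) ∧
        (∀ (t : v.adicCompletion F) (u : LocalSp F (3 + 3) (gramD F 3 T) v),
          (∀ w, (u : _ ≃ₗ[v.adicCompletion F] _) w = w + t • 𝔫' w) →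
            g₀ * u * g₀⁻¹ =
              partialWeyl (localGram F (3 + 3) (gramD F 3 T) v)
                  (UnitaryGroup.isUnit_det_map (algebraMap F (v.adicCompletion F)) (isUnit_det_gramD F 3 hTd))
                  e' *
                unipotentSp (localPairing F (3 + 3) (gramD F 3 T) v) (t • c₀')
                  (symm_smul_of_symm (localPairing F (3 + 3) (gramD F 3 T) v) c₀' hc₀' t) *
                (partialWeyl (localGram F (3 + 3) (gramD F 3 T) v)
                  (UnitaryGroup.isUnit_det_map (algebraMap F (v.adicCompletion F)) (isUnit_det_gramD F 3 hTd))
                  e')⁻¹) := by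
    haveI : CharZero (v.adicCompletion F) :=
      charZero_of_injective_algebraMap (algebraMap F (v.adicCompletion F)).injective
    haveI : Invertible (2 : v.adicCompletion F) := invertibleOfNonzero two_ne_zero
    obtain ⟨nr, nr', 𝔫, 𝔫', hp, hp', hsq, hsq', hskew, hskew', hd₁', hd₂', hrank, -, han, han'⟩ :=
      exists_doubledRootNilpotents F E c (le_refl 3) hcδ₁ hδ₁ hd₁ hcδ₂ hδ₂ hd₂ T hT hTd hJ v hE hcls s₁ s₂ hs₁ hs₂
    exact ⟨nr, nr', 𝔫, 𝔫', hp, hp',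
      exists_mover_two_rootFamilies e' (localGram F (3 + 3) (gramD F 3 T) v)
        (UnitaryGroup.isUnit_det_map (algebraMap F (v.adicCompletion F)) (isUnit_det_gramD F 3 hTd)) 𝔫 𝔫'
        hskew hskew' hsq hsq' hd₁' hd₂' (hrank.trans (Fintype.card_fin 4).symm) han han'⟩
  obtain ⟨nr, nr', 𝔫, 𝔫', hp, hp', g₀, c₀, c₀', hc₀, hc₀', hsupp, hsupp', hanis, hanis', hconj, hconj'⟩ := hP34
  -- the ENGINE
  exact false_of_quasiInvariant_rootFamilies F v (3 + 3) (gramD F 3 T) (isUnit_det_gramD F 3 hTd)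
    e' Λ hΛ0 g₀
    (fun t => diagonalDoubling F E c v 3 s₁ s₂ (nr t)) (fun t => diagonalDoubling F E c v 3 s₁ s₂ (nr' t))
    (fun t => hΛ𝔻 (nr t)) (fun t => hΛ𝔻 (nr' t)) c₀ c₀' hc₀ hc₀' hsupp hsupp' hanis hanis'
    (fun t => hconj t _ (hp t)) (fun t => hconj' t _ (hp' t))

end Literature.RepresentationTheory.MoeglinVignerasWaldspurger1987

end
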